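import Literature.AlgebraicGeometry.Frobenioids.BaseCategoryTheoreticityInstancesIstr
import Literature.AlgebraicGeometry.Frobenioids.EquivalencePreStepsFSMFF2008Assembly
import Literature.AlgebraicGeometry.Frobenioids.PerfectionFunctorialityCompatibleClosure
import HarnessLib

/-!
# Frobenioids I, Theorem 3.4 (iii)–(v) at the Frobenioids, UNCONDITIONAL: the instance forms of the typed
# schemata `Thm34iii_pf`, `Thm34iv`, `Thm34iv_untr`, `Thm34v` of `BaseCategoryTheoreticity.lean`

Mochizuki, *The geometry of Frobenioids I: the general theory*, Kyushu J. Math. **62** (2008)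
293–400, Thm. 3.4 (iii) p. 62 l. 42 – p. 63 l. 2, (iv) p. 62 l. 36 – p. 63 l. 21, (v) p. 63 ll. 22–37
[cite: MochizukiFrdI2008, Thm. 3.4 (iv) p.63].

PROOF-ONLY companion of `BaseCategoryTheoreticity.lean` (seat abc-iut-L1-t3) and closer of
`BaseCategoryTheoreticityInstances.lean` / `BaseCategoryTheoreticityInstancesIstr.lean` (seat abc-iut-f-019;
FACT-LIST rows F-0904 – F-0907): the `_of_` closers there are fed with the cell's theorems `FrdI.Thm34iii_holds`,
`FrdI.Thm34iv_holds`, `FrdI.Thm34v_holds` (seat abc-iut-L1-t11, `EquivalencePreStepsFSMFF2008Assembly.lean`,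
[FrdI] Thm. 3.4 (ii)–(v) in the 2008 printed wording), so that for EVERY pair of Frobenioids `F_i : C_i → F_{Φ_i}`
and every equivalence `Ψ : C₁ ⥲ C₂`, with no hypothesis beyond the printed ones:

* `FrdI.thm34iv_ofFunctor`, `FrdI.thm34v_ofFunctor` — the typed `PreFrobenioidData.Thm34iv` / `Thm34v` at
  `ofFunctor` (F-0905 / F-0907: instance forms = the bodies of the 0-ary facts);
* `FrdI.thm34iv_untr_ofFunctor` (and `…'` without instance argument) — the typed `PreFrobenioidData.Thm34iv_untr`
  (F-0906) at `ofFunctor` and at THE `Ψ^istr` (the restriction of `Ψ` to `C^istr`), for Frobenioids of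
  quasi-isotropic type; `FrdI.thm34iv_untr_ofFunctor_of_oneCommutes` — the same at EVERY functor
  `Ψ^istr : C₁^istr ⥤ C₂^istr` fitting the `1`-commutative square of Thm. 3.4 (i);
* `FrdI.isFrobeniusCompatible_of_not_isGroupLikeObj` — under (a), (b) and a non-group-like object of `C₁`, `Ψ`
  carries arrows of Frobenius type to arrows of Frobenius type of the same degree ((iii): `Ψ^{ℕ≥1} = id`; the
  non-group-like object of `C₂` comes from (ii), `FrdI.groupLike_dichotomy_of_thm34ii`); hence
  `FrdI.thm34iii_pf_ofFunctor_of_isOfPerfectType_of_not_isGroupLikeObj` — the typed `PreFrobenioidData.Thm34iii_pf`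
  (F-0904) at THE perfections for `C₁` of perfect type with a non-group-like object (the both-sides-perfect case is
  `FrdI.thm34iii_pf_ofFunctor_of_isOfPerfectType`; outside perfect type the bare reading is false,
  `DegreeModel.not_thm34iii_pf`).

No definition; no statement of the paper is restated or strengthened; nothing here bears on [IUTchIII].
-/

namespace Literature.AlgebraicGeometry.Frobenioids

namespace FrdI

open CategoryTheory PreFrobenioidData

universe w v v' u u'

section Two

variable {D₁ : Type u} [Category.{v} D₁] {Φ₁ : D₁ᵒᵖ ⥤ CommMonCat.{w}} {C₁ : Type u'} [Category.{v'} C₁]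
  {D₂ : Type u} [Category.{v} D₂] {Φ₂ : D₂ᵒᵖ ⥤ CommMonCat.{w}} {C₂ : Type u'} [Category.{v'} C₂]
  {F₁ : C₁ ⥤ ElemFrobenioid Φ₁} {F₂ : C₂ ⥤ ElemFrobenioid Φ₂}

/-! ### (iv), preservation part, and (v): instance forms of the 0-ary named facts -/

/-- **[FrdI] Thm. 3.4 (iv), preservation part, AS TYPED at the Frobenioids**: for every pair of Frobenioids
and every equivalence `Ψ`, under (a) standard type, (b) `HypB`, (c) Frobenius-slim bases, `Ψ` preserves
`O^▷(−)`, `O^×(−)` and Frobenius degrees (instance of the cell's named fact `FrdI.Thm34iv`, a theorem).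
[cite: MochizukiFrdI2008, Thm. 3.4 (iv) p.63] -/
theorem thm34iv_ofFunctor (hF₁ : PreFrobenioid.IsFrobenioid F₁) (hF₂ : PreFrobenioid.IsFrobenioid F₂)
    (Ψ : C₁ ≌ C₂) : (ofFunctor Φ₁ F₁).Thm34iv (ofFunctor Φ₂ F₂) Ψ :=
  Thm34iv_holds F₁ F₂ hF₁ hF₂ Ψ

/-- **[FrdI] Thm. 3.4 (v) AS TYPED at the Frobenioids**: for every pair of Frobenioids and every equivalence
`Ψ`, under (a), (b), (c) slim bases, `Ψ` preserves base-identity endomorphisms and base-equivalent pairs, and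
`Ψ^Base : D₁ ⥲ D₂` exists `1`-uniquely with rigid composites (instance of the named fact `FrdI.Thm34v`).
[cite: MochizukiFrdI2008, Thm. 3.4 (v) p.63] -/
theorem thm34v_ofFunctor (hF₁ : PreFrobenioid.IsFrobenioid F₁) (hF₂ : PreFrobenioid.IsFrobenioid F₂)
    (Ψ : C₁ ≌ C₂) : (ofFunctor Φ₁ F₁).Thm34v (ofFunctor Φ₂ F₂) Ψ :=
  Thm34v_holds F₁ F₂ hF₁ hF₂ Ψ

/-! ### (iv), the unit-trivialisation square at THE `Ψ^istr`, unconditionally -/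

/-- **[FrdI] Thm. 3.4 (iv), the unit-trivialisation square, AS TYPED at the Frobenioids and at THE `Ψ^istr`**:
for every pair of Frobenioids of quasi-isotropic type (clause of (a); it names `Ψ^istr :=` the restriction of
`Ψ` to the isotropic objects, Thm. 3.4 (i)) and every equivalence `Ψ`, under (a) standard type, (b) `HypB`,
(c) Frobenius-slim bases there is a `1`-unique equivalence `Ψ^un-tr : C₁^un-tr ⥲ C₂^un-tr` with
`Ψ^un-tr ∘ (C₁^istr → C₁^un-tr) ≅ (C₂^istr → C₂^un-tr) ∘ Ψ^istr`, and for slim bases both composites are rigid —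
`thm34iv_untr_ofFunctor_of_thm34iv` fed with `FrdI.Thm34iv_holds` for `Ψ` and `Ψ⁻¹`.
[cite: MochizukiFrdI2008, Thm. 3.4 (iv) p.63] -/
theorem thm34iv_untr_ofFunctor (hF₁ : PreFrobenioid.IsFrobenioid F₁) (hF₂ : PreFrobenioid.IsFrobenioid F₂)
    (hq₁ : (ofFunctor Φ₁ F₁).IsOfQuasiIsotropicType) (hq₂ : (ofFunctor Φ₂ F₂).IsOfQuasiIsotropicType)
    (Ψ : C₁ ≌ C₂) [(ofFunctor Φ₂ F₂).isotropicObjects.IsClosedUnderIsomorphisms] :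
    (ofFunctor Φ₁ F₁).Thm34iv_untr (ofFunctor Φ₂ F₂) Ψ
      (Ψ.congrFullSubcategory (isotropicObjects_ofFunctor_inverseImage hF₁ hq₁ hq₂ Ψ)).functor :=
  thm34iv_untr_ofFunctor_of_thm34iv hF₁ hF₂ hq₁ hq₂ Ψ (Thm34iv_holds F₁ F₂ hF₁ hF₂ Ψ)
    (Thm34iv_holds F₂ F₁ hF₂ hF₁ Ψ.symm)

/-- The same with the closure-under-isomorphisms of the isotropic objects supplied (no instance argument):
hypotheses = two Frobenioids of quasi-isotropic type and an equivalence, nothing else.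
[cite: MochizukiFrdI2008, Thm. 3.4 (iv) p.63] -/
theorem thm34iv_untr_ofFunctor' (hF₁ : PreFrobenioid.IsFrobenioid F₁) (hF₂ : PreFrobenioid.IsFrobenioid F₂)
    (hq₁ : (ofFunctor Φ₁ F₁).IsOfQuasiIsotropicType) (hq₂ : (ofFunctor Φ₂ F₂).IsOfQuasiIsotropicType)
    (Ψ : C₁ ≌ C₂) :
    haveI := isClosedUnderIsomorphisms_isotropicObjects_ofFunctor (Φ₂ := Φ₂) hF₂
    (ofFunctor Φ₁ F₁).Thm34iv_untr (ofFunctor Φ₂ F₂) Ψ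
      (Ψ.congrFullSubcategory (isotropicObjects_ofFunctor_inverseImage hF₁ hq₁ hq₂ Ψ)).functor :=
  haveI := isClosedUnderIsomorphisms_isotropicObjects_ofFunctor (Φ₂ := Φ₂) hF₂
  thm34iv_untr_ofFunctor hF₁ hF₂ hq₁ hq₂ Ψ

/-- **[FrdI] Thm. 3.4 (iv), the unit-trivialisation square, at EVERY `Ψ^istr` as in Thm. 3.4 (i),
unconditionally**: for Frobenioids of quasi-isotropic type, an equivalence `Ψ`, and ANY functor
`Ψ^istr : C₁^istr ⥤ C₂^istr` making the square of Thm. 3.4 (i) with the isotropification functors `1`-commute,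
the typed `PreFrobenioidData.Thm34iv_untr` holds at `(ofFunctor Φ₁ F₁, ofFunctor Φ₂ F₂, Ψ, Ψ^istr)`.
[cite: MochizukiFrdI2008, Thm. 3.4 (iv) p.63] -/
theorem thm34iv_untr_ofFunctor_of_oneCommutes (hF₁ : PreFrobenioid.IsFrobenioid F₁)
    (hF₂ : PreFrobenioid.IsFrobenioid F₂) (hq₁ : (ofFunctor Φ₁ F₁).IsOfQuasiIsotropicType)
    (hq₂ : (ofFunctor Φ₂ F₂).IsOfQuasiIsotropicType) (Ψ : C₁ ≌ C₂)
    (Ψistr : (ofFunctor Φ₁ F₁).Istr ⥤ (ofFunctor Φ₂ F₂).Istr)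
    (hsq : OneCommutes Ψ.functor
      (PreFrobenioid.isotropification hF₂ ⋙ ObjectProperty.ιOfLE (PreFrobenioid.isotropicObjects_le_ofFunctor F₂))
      (PreFrobenioid.isotropification hF₁ ⋙ ObjectProperty.ιOfLE (PreFrobenioid.isotropicObjects_le_ofFunctor F₁))
      Ψistr) :
    (ofFunctor Φ₁ F₁).Thm34iv_untr (ofFunctor Φ₂ F₂) Ψ Ψistr :=
  thm34iv_untr_ofFunctor_of_thm34iv_of_oneCommutes hF₁ hF₂ hq₁ hq₂ Ψ (Thm34iv_holds F₁ F₂ hF₁ hF₂ Ψ)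
    (Thm34iv_holds F₂ F₁ hF₂ hF₁ Ψ.symm) Ψistr hsq

/-! ### (iii), the perfection square at THE perfections, `C₁` of perfect type with a non-group-like object -/

/-- An equivalence between Frobenioids of standard type satisfying `HypB`, with a non-group-like object of
`C₁`, is compatible with arrows of Frobenius type and their degrees — UNCONDITIONALLY: Thm. 3.4 (iii)
(`FrdI.Thm34iii_holds`) gives preservation of Frobenius type and `deg_Fr(Ψ φ) = Ψ^{ℕ≥1}(deg_Fr φ)` with
`Ψ^{ℕ≥1} = id` as soon as both sides have non-group-like objects (seat abc-iut-w4-d093's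
`PreFrobenioid.isFrobeniusCompatible_of_thm34iii`) — and `C₂` has one by Thm. 3.4 (ii) (group-like objects are
preserved by `Ψ⁻¹`: `FrdI.groupLike_dichotomy_of_thm34ii` fed with `FrdI.thm34ii_ofFunctor`).
[cite: MochizukiFrdI2008, Thm. 3.4 (iii) p.62] -/
theorem isFrobeniusCompatible_of_not_isGroupLikeObj (hF₁ : PreFrobenioid.IsFrobenioid F₁)
    (hF₂ : PreFrobenioid.IsFrobenioid F₂) (Ψ : C₁ ≌ C₂) (hs₁ : (ofFunctor Φ₁ F₁).IsOfStandardType)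
    (hs₂ : (ofFunctor Φ₂ F₂).IsOfStandardType) (hB : (ofFunctor Φ₁ F₁).HypB (ofFunctor Φ₂ F₂) Ψ)
    (hN₁ : ∃ A : C₁, ¬ (ofFunctor Φ₁ F₁).IsGroupLikeObj A) :
    PreFrobenioid.IsFrobeniusCompatible F₁ F₂ Ψ.functor := by
  have hN₂ : ∃ A : C₂, ¬ (ofFunctor Φ₂ F₂).IsGroupLikeObj A := by
    rcases groupLike_dichotomy_of_thm34ii Ψ (thm34ii_ofFunctor hF₁ hF₂ Ψ) (thm34ii_ofFunctor hF₂ hF₁ Ψ.symm)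
      hs₁ hs₂ with ⟨hg₁, -⟩ | ⟨-, h₂⟩
    · obtain ⟨A, hA⟩ := hN₁
      exact (hA (hg₁.obj A)).elim
    · exact h₂
  exact PreFrobenioid.isFrobeniusCompatible_of_thm34iii Thm34iii_holds hF₁ hF₂ Ψ hs₁ hs₂ hB hN₁ hN₂

/-- **[FrdI] Thm. 3.4 (iii), the perfection square AS TYPED at THE perfections, `C₁` of perfect type with a
non-group-like object** (`C₂` arbitrary): `Ψ^pf := Perfection.map` (seat abc-iut-L1-d1) for the
Frobenius-compatible `Ψ` (`isFrobeniusCompatible_of_not_isGroupLikeObj`), `1`-unique by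
`Perfection.oneUniqueSquare_map_of_isOfPerfectType`, composites rigid by Prop. 1.13 (ii).
[cite: MochizukiFrdI2008, Thm. 3.4 (iii) p.62] -/
theorem thm34iii_pf_ofFunctor_of_isOfPerfectType_of_not_isGroupLikeObj
    (hF₁ : PreFrobenioid.IsFrobenioid F₁) (hF₂ : PreFrobenioid.IsFrobenioid F₂)
    (hP₁ : PreFrobenioid.IsOfPerfectType F₁) (hN₁ : ∃ A : C₁, ¬ (ofFunctor Φ₁ F₁).IsGroupLikeObj A)
    (Ψ : C₁ ≌ C₂) :
    (ofFunctor Φ₁ F₁).Thm34iii_pf (ofFunctor Φ₂ F₂) Ψ (perfection hF₁) (perfection hF₂) :=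
  fun hs₁ hs₂ hB =>
    thm34iii_pf_ofFunctor_of_isOfPerfectType_of_isFrobeniusCompatible hF₁ hF₂ hP₁ Ψ
      (isFrobeniusCompatible_of_not_isGroupLikeObj hF₁ hF₂ Ψ hs₁ hs₂ hB hN₁) hs₁ hs₂ hB

end Two

end FrdI

end Literature.AlgebraicGeometry.Frobenioids
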